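import Mathlib.GroupTheory.QuotientGroup.Defs
import Mathlib.Tactic.Module
import HarnessLib

/-!
# Laws for an action on a commutative group that are determined on ONE generator modulo units —
# the cocycle bookkeeping behind the `Z`-action clause of [EtTh] Prop. 1.5 (iii) (pure group theory)

S. Mochizuki, *The étale theta function and its Frobenioid-theoretic manifestations*, Publ. RIMS **45**
(2009) [EtTh], §1, Prop. 1.5 (iii), PRIMS PDF p. 23 (printed 249): "… on which `a ∈ Z ≅ ℤ ≅ Π^tp_X/Π^tp_Y`
acts as follows: `η̈^Θ ↦ η̈^Θ − 2a·log(Ü) − (a²/2)·log(q_X) + log(O^×_K̈)` — where we use the notation 'log'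
to express the fact that we wish to write the group structure of `(K̈^×)^∧` additively"
[cite: MochizukiEtTh2009, Prop 1.5 (iii) p.23]. Layer L2 of the abc-iut cell, seat abc-iut-L2-t12 (gen 5),
ROW R184 of abc-iut-L2-lead (gen 3) «Prop 1.5 (iii) FACT → THEOREM, group side»; support file of
`Discharge/Sec1Prop15iiiZLawOfGenerators.lean`, which instantiates it at the `ThetaSetting` root.

PURE GROUP THEORY (no topology, no [EtTh] object). Data: a commutative group `M` written multiplicatively
(print writes it additively), maps `ρ_σ : M →* M` indexed by a group `G` with `ρ_1 = id`,
`ρ_{στ} = ρ_σ ∘ ρ_τ` (in [EtTh]: conjugation by `σ ∈ Π^tp_X` on `H¹((Π^tp_Ÿ)^Θ, Δ_Θ)`), a "unit"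
homomorphism `κ : V →* M` with a `ρ`-stable unit subgroup `V₀ ≤ V` (`κ(O^×_K̈)`), an element `q ∈ V` with
`ρ_σ κ(q) ∈ κ(q)·κ(V₀)` (`q̈ ↦ ±q̈`), and a degree `a : G →* ℤ` (`toZ`). Results:
* `ZLaw.of_generator` — a predicate on `G` closed under products and inverses that holds at one `σ₀` with
  `a σ₀ = 1` and on `Ker a` holds everywhere;
* the UNIT law `ρ_σ x ∈ x·κ(V₀)`: `unitLaw_one/mul/inv/closure`;
* the DEGREE-ONE law `ρ_σ L ∈ L·κ(q)^{a(σ)}·κ(V₀)` (print: `σ·log(Ü) = log(Ü) + a·log(q̈) + unit`):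
  `lawL_mul/inv/of_generator`;
* the DEGREE-TWO law `ρ_σ x ∈ x·L^{−2a(σ)}·κ(q)^{−a(σ)²}·κ(V₀)` (print's display for `η̈^Θ`), given the
  degree-one law for `L`: `lawX_mul/inv/of_generator` — the cocycle identity `δ(στ) = δ(σ)·ρ_σ(δ(τ))` of
  `δ(σ) := ρ_σ(x)/x` turns the exponents `(−2a, −a²)`, `(−2b, −b²)` into `(−2(a+b), −(a+b)²)`.
The exponent algebra is discharged by transport to `Additive M` and the `module` tactic. PROOF-ONLY: no
`def`, no instance. HONEST FRAMING: classical bookkeeping ([folklore]); nothing of [EtTh] is asserted; no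
side is taken on [IUTchIII] Cor. 3.12.
-/

namespace Literature.AnabelianGeometry.EtaleTheta

/-! ## Abstract core: laws for an action, determined on a generator modulo units -/

namespace ZLaw

variable {G M V : Type*} [Group G] [CommGroup M] [Group V]
  {ρ : G → M →* M} {κ : V →* M} {V₀ : Subgroup V} {a : G →* Multiplicative ℤ} {q : V} {L x : M}

/-- **A law closed under products and inverses holds everywhere once it holds at one element of degree
`1` and on the degree-`0` subgroup** (`G` is generated by `Ker a` and any `σ₀` with `a σ₀ = 1`).
[cite: MochizukiEtTh2009, Prop 1.5 (iii) p.23] -/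
theorem of_generator {P : G → Prop} (a : G →* Multiplicative ℤ)
    (hmul : ∀ σ τ, P σ → P τ → P (σ * τ)) (hinv : ∀ σ, P σ → P σ⁻¹)
    {σ₀ : G} (hσ₀ : a σ₀ = Multiplicative.ofAdd 1) (h0 : P σ₀) (hker : ∀ y, a y = 1 → P y) :
    ∀ σ, P σ := by
  have h1 : P 1 := hker 1 (map_one a)
  have hpow : ∀ n : ℕ, P (σ₀ ^ n) := fun n => by
    induction n with
    | zero => simpa using h1
    | succ n ih => rw [pow_succ]; exact hmul _ _ ih h0
  have hzpow : ∀ n : ℤ, P (σ₀ ^ n) := fun n => by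
    obtain ⟨k, rfl | rfl⟩ := Int.eq_nat_or_neg n
    · rw [zpow_natCast]; exact hpow k
    · rw [zpow_neg, zpow_natCast]; exact hinv _ (hpow k)
  intro σ
  set n : ℤ := Multiplicative.toAdd (a σ) with hn
  have han : a σ = Multiplicative.ofAdd n := by rw [hn, ofAdd_toAdd]
  have hpn : a (σ₀ ^ n) = Multiplicative.ofAdd n := by
    rw [map_zpow, hσ₀, ← ofAdd_zsmul, smul_eq_mul, mul_one]
  have hy : a (σ * (σ₀ ^ n)⁻¹) = 1 := by rw [map_mul, map_inv, hpn, han, mul_inv_cancel]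
  have h := hmul _ _ (hker _ hy) (hzpow n)
  rwa [inv_mul_cancel_right] at h

/-! ### The unit law `ρ_σ x ∈ x · κ(V₀)` -/

/-- The unit law at `1`. [cite: MochizukiEtTh2009, Prop 1.5 (iii) p.23] -/
theorem unitLaw_one (hρ1 : ∀ m, ρ 1 m = m) : ∃ v ∈ V₀, ρ 1 x = x * κ v :=
  ⟨1, V₀.one_mem, by rw [hρ1, map_one, mul_one]⟩

/-- The unit law is closed under products (`κ(V₀)` is `ρ`-stable). [cite: MochizukiEtTh2009, Prop 1.5 (iii) p.23] -/
theorem unitLaw_mul (hρmul : ∀ σ τ m, ρ (σ * τ) m = ρ σ (ρ τ m))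
    (hκ : ∀ σ, ∀ v ∈ V₀, ∃ v' ∈ V₀, ρ σ (κ v) = κ v') {σ τ : G}
    (hσ : ∃ v ∈ V₀, ρ σ x = x * κ v) (hτ : ∃ v ∈ V₀, ρ τ x = x * κ v) :
    ∃ v ∈ V₀, ρ (σ * τ) x = x * κ v := by
  obtain ⟨vσ, hvσ, hσ⟩ := hσ
  obtain ⟨vτ, hvτ, hτ⟩ := hτ
  obtain ⟨vτ', hvτ', hτ'⟩ := hκ σ vτ hvτ
  refine ⟨vσ * vτ', V₀.mul_mem hvσ hvτ', ?_⟩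
  rw [hρmul, hτ, map_mul, hσ, hτ', map_mul, mul_assoc]

/-- The unit law is closed under inverses. [cite: MochizukiEtTh2009, Prop 1.5 (iii) p.23] -/
theorem unitLaw_inv (hρ1 : ∀ m, ρ 1 m = m) (hρmul : ∀ σ τ m, ρ (σ * τ) m = ρ σ (ρ τ m))
    (hκ : ∀ σ, ∀ v ∈ V₀, ∃ v' ∈ V₀, ρ σ (κ v) = κ v') {σ : G}
    (hσ : ∃ v ∈ V₀, ρ σ x = x * κ v) : ∃ v ∈ V₀, ρ σ⁻¹ x = x * κ v := by
  obtain ⟨vσ, hvσ, hσ⟩ := hσ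
  obtain ⟨v', hv', hv'eq⟩ := hκ σ⁻¹ vσ hvσ
  have key : x = ρ σ⁻¹ x * κ v' := by
    have h := congrArg (ρ σ⁻¹) hσ
    rw [← hρmul, inv_mul_cancel, hρ1, map_mul, hv'eq] at h
    exact h
  refine ⟨v'⁻¹, V₀.inv_mem hv', ?_⟩
  rw [map_inv, eq_mul_inv_iff_mul_eq, ← key]

/-- The unit law on a generating set extends to the generated subgroup. [cite: MochizukiEtTh2009, Prop 1.5 (iii) p.23] -/
theorem unitLaw_closure (hρ1 : ∀ m, ρ 1 m = m) (hρmul : ∀ σ τ m, ρ (σ * τ) m = ρ σ (ρ τ m))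
    (hκ : ∀ σ, ∀ v ∈ V₀, ∃ v' ∈ V₀, ρ σ (κ v) = κ v') {S : Set G}
    (hS : ∀ s ∈ S, ∃ v ∈ V₀, ρ s x = x * κ v) :
    ∀ σ ∈ Subgroup.closure S, ∃ v ∈ V₀, ρ σ x = x * κ v := by
  intro σ hσ
  induction hσ using Subgroup.closure_induction with
  | mem s hs => exact hS s hs
  | one => exact unitLaw_one hρ1
  | mul σ τ _ _ ihσ ihτ => exact unitLaw_mul hρmul hκ ihσ ihτ
  | inv σ _ ih => exact unitLaw_inv hρ1 hρmul hκ ih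

/-! ### The degree-one law `ρ_σ L ∈ L · κ(q)^{a(σ)} · κ(V₀)` -/

/-- The degree-one law is closed under products. [cite: MochizukiEtTh2009, Prop 1.5 (iii) p.23] -/
theorem lawL_mul (hρmul : ∀ σ τ m, ρ (σ * τ) m = ρ σ (ρ τ m))
    (hκ : ∀ σ, ∀ v ∈ V₀, ∃ v' ∈ V₀, ρ σ (κ v) = κ v')
    (hq : ∀ σ, ∃ v ∈ V₀, ρ σ (κ q) = κ q * κ v) {σ τ : G}
    (hσ : ∃ v ∈ V₀, ρ σ L = L * κ q ^ Multiplicative.toAdd (a σ) * κ v)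
    (hτ : ∃ v ∈ V₀, ρ τ L = L * κ q ^ Multiplicative.toAdd (a τ) * κ v) :
    ∃ v ∈ V₀, ρ (σ * τ) L = L * κ q ^ Multiplicative.toAdd (a (σ * τ)) * κ v := by
  obtain ⟨vσ, hvσ, hσ⟩ := hσ
  obtain ⟨vτ, hvτ, hτ⟩ := hτ
  obtain ⟨vq, hvq, hqσ⟩ := hq σ
  obtain ⟨vτ', hvτ', hτ'⟩ := hκ σ vτ hvτ
  refine ⟨vσ * vq ^ Multiplicative.toAdd (a τ) * vτ',
    V₀.mul_mem (V₀.mul_mem hvσ (V₀.zpow_mem hvq _)) hvτ', ?_⟩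
  rw [hρmul, hτ]
  simp only [map_mul, map_zpow, toAdd_mul]
  rw [hσ, hqσ, hτ']
  apply Additive.ofMul.injective
  simp only [ofMul_mul, ofMul_zpow]
  module

/-- The degree-one law is closed under inverses. [cite: MochizukiEtTh2009, Prop 1.5 (iii) p.23] -/
theorem lawL_inv (hρ1 : ∀ m, ρ 1 m = m) (hρmul : ∀ σ τ m, ρ (σ * τ) m = ρ σ (ρ τ m))
    (hκ : ∀ σ, ∀ v ∈ V₀, ∃ v' ∈ V₀, ρ σ (κ v) = κ v')
    (hq : ∀ σ, ∃ v ∈ V₀, ρ σ (κ q) = κ q * κ v) {σ : G}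
    (hσ : ∃ v ∈ V₀, ρ σ L = L * κ q ^ Multiplicative.toAdd (a σ) * κ v) :
    ∃ v ∈ V₀, ρ σ⁻¹ L = L * κ q ^ Multiplicative.toAdd (a σ⁻¹) * κ v := by
  obtain ⟨vσ, hvσ, hσ⟩ := hσ
  obtain ⟨vq, hvq, hqi⟩ := hq σ⁻¹
  obtain ⟨v', hv', hv'eq⟩ := hκ σ⁻¹ vσ hvσ
  have key : ρ σ⁻¹ L = L * ((κ q * κ vq) ^ Multiplicative.toAdd (a σ) * κ v')⁻¹ := by
    have h := congrArg (ρ σ⁻¹) hσ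
    rw [← hρmul, inv_mul_cancel, hρ1] at h
    simp only [map_mul, map_zpow] at h
    rw [hqi, hv'eq, mul_assoc] at h
    exact eq_mul_inv_of_mul_eq h.symm
  refine ⟨(vq ^ Multiplicative.toAdd (a σ) * v')⁻¹, V₀.inv_mem (V₀.mul_mem (V₀.zpow_mem hvq _) hv'), ?_⟩
  rw [key, map_inv a, toAdd_inv]
  simp only [map_mul, map_zpow, map_inv]
  apply Additive.ofMul.injective
  simp only [ofMul_mul, ofMul_zpow, ofMul_inv]
  module

/-- **The degree-one law from a generator.** [cite: MochizukiEtTh2009, Prop 1.5 (iii) p.23] -/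
theorem lawL_of_generator (hρ1 : ∀ m, ρ 1 m = m) (hρmul : ∀ σ τ m, ρ (σ * τ) m = ρ σ (ρ τ m))
    (hκ : ∀ σ, ∀ v ∈ V₀, ∃ v' ∈ V₀, ρ σ (κ v) = κ v')
    (hq : ∀ σ, ∃ v ∈ V₀, ρ σ (κ q) = κ q * κ v)
    {σ₀ : G} (hσ₀ : a σ₀ = Multiplicative.ofAdd 1)
    (h0 : ∃ v ∈ V₀, ρ σ₀ L = L * κ q ^ Multiplicative.toAdd (a σ₀) * κ v)
    (hker : ∀ y, a y = 1 → ∃ v ∈ V₀, ρ y L = L * κ v) :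
    ∀ σ, ∃ v ∈ V₀, ρ σ L = L * κ q ^ Multiplicative.toAdd (a σ) * κ v := by
  refine of_generator (P := fun σ => ∃ v ∈ V₀, ρ σ L = L * κ q ^ Multiplicative.toAdd (a σ) * κ v) a
    (fun σ τ hσ hτ => lawL_mul hρmul hκ hq hσ hτ) (fun σ hσ => lawL_inv hρ1 hρmul hκ hq hσ) hσ₀ h0 ?_
  intro y hy
  obtain ⟨v, hv, h⟩ := hker y hy
  exact ⟨v, hv, by rw [h, hy, toAdd_one, zpow_zero, mul_one]⟩

/-! ### The degree-two law `ρ_σ x ∈ x · L^{−2a(σ)} · κ(q)^{−a(σ)²} · κ(V₀)` -/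

/-- The degree-two law is closed under products, given the degree-one law for `L`: the exponents
`−2a − 2b = −2(a+b)` and `−a² − 2ab − b² = −(a+b)²`. [cite: MochizukiEtTh2009, Prop 1.5 (iii) p.23] -/
theorem lawX_mul (hρmul : ∀ σ τ m, ρ (σ * τ) m = ρ σ (ρ τ m))
    (hκ : ∀ σ, ∀ v ∈ V₀, ∃ v' ∈ V₀, ρ σ (κ v) = κ v')
    (hq : ∀ σ, ∃ v ∈ V₀, ρ σ (κ q) = κ q * κ v)
    (hL : ∀ σ, ∃ v ∈ V₀, ρ σ L = L * κ q ^ Multiplicative.toAdd (a σ) * κ v) {σ τ : G}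
    (hσ : ∃ v ∈ V₀, ρ σ x = x * L ^ (-(2 * Multiplicative.toAdd (a σ))) *
      κ q ^ (-(Multiplicative.toAdd (a σ) * Multiplicative.toAdd (a σ))) * κ v)
    (hτ : ∃ v ∈ V₀, ρ τ x = x * L ^ (-(2 * Multiplicative.toAdd (a τ))) *
      κ q ^ (-(Multiplicative.toAdd (a τ) * Multiplicative.toAdd (a τ))) * κ v) :
    ∃ v ∈ V₀, ρ (σ * τ) x = x * L ^ (-(2 * Multiplicative.toAdd (a (σ * τ)))) *
      κ q ^ (-(Multiplicative.toAdd (a (σ * τ)) * Multiplicative.toAdd (a (σ * τ)))) * κ v := by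
  obtain ⟨vσ, hvσ, hσ⟩ := hσ
  obtain ⟨vτ, hvτ, hτ⟩ := hτ
  obtain ⟨vq, hvq, hqσ⟩ := hq σ
  obtain ⟨vL, hvL, hLσ⟩ := hL σ
  obtain ⟨vτ', hvτ', hτ'⟩ := hκ σ vτ hvτ
  refine ⟨vσ * vL ^ (-(2 * Multiplicative.toAdd (a τ))) *
      vq ^ (-(Multiplicative.toAdd (a τ) * Multiplicative.toAdd (a τ))) * vτ',
    V₀.mul_mem (V₀.mul_mem (V₀.mul_mem hvσ (V₀.zpow_mem hvL _)) (V₀.zpow_mem hvq _)) hvτ', ?_⟩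
  rw [hρmul, hτ]
  simp only [map_mul, map_zpow, toAdd_mul]
  rw [hσ, hLσ, hqσ, hτ']
  apply Additive.ofMul.injective
  simp only [ofMul_mul, ofMul_zpow]
  module

/-- The degree-two law is closed under inverses, given the degree-one law for `L`.
[cite: MochizukiEtTh2009, Prop 1.5 (iii) p.23] -/
theorem lawX_inv (hρ1 : ∀ m, ρ 1 m = m) (hρmul : ∀ σ τ m, ρ (σ * τ) m = ρ σ (ρ τ m))
    (hκ : ∀ σ, ∀ v ∈ V₀, ∃ v' ∈ V₀, ρ σ (κ v) = κ v')
    (hq : ∀ σ, ∃ v ∈ V₀, ρ σ (κ q) = κ q * κ v)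
    (hL : ∀ σ, ∃ v ∈ V₀, ρ σ L = L * κ q ^ Multiplicative.toAdd (a σ) * κ v) {σ : G}
    (hσ : ∃ v ∈ V₀, ρ σ x = x * L ^ (-(2 * Multiplicative.toAdd (a σ))) *
      κ q ^ (-(Multiplicative.toAdd (a σ) * Multiplicative.toAdd (a σ))) * κ v) :
    ∃ v ∈ V₀, ρ σ⁻¹ x = x * L ^ (-(2 * Multiplicative.toAdd (a σ⁻¹))) *
      κ q ^ (-(Multiplicative.toAdd (a σ⁻¹) * Multiplicative.toAdd (a σ⁻¹))) * κ v := by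
  obtain ⟨vσ, hvσ, hσ⟩ := hσ
  obtain ⟨vq, hvq, hqi⟩ := hq σ⁻¹
  obtain ⟨vL, hvL, hLi⟩ := hL σ⁻¹
  obtain ⟨v', hv', hv'eq⟩ := hκ σ⁻¹ vσ hvσ
  rw [map_inv a, toAdd_inv] at hLi ⊢
  have key : ρ σ⁻¹ x = x * ((L * κ q ^ (-Multiplicative.toAdd (a σ)) * κ vL) ^
      (-(2 * Multiplicative.toAdd (a σ))) * (κ q * κ vq) ^
      (-(Multiplicative.toAdd (a σ) * Multiplicative.toAdd (a σ))) * κ v')⁻¹ := by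
    have h := congrArg (ρ σ⁻¹) hσ
    rw [← hρmul, inv_mul_cancel, hρ1] at h
    simp only [map_mul, map_zpow] at h
    rw [hLi, hqi, hv'eq, mul_assoc, mul_assoc] at h
    rw [mul_assoc]
    exact eq_mul_inv_of_mul_eq h.symm
  refine ⟨(vL ^ (-(2 * Multiplicative.toAdd (a σ))) *
      vq ^ (-(Multiplicative.toAdd (a σ) * Multiplicative.toAdd (a σ))) * v')⁻¹,
    V₀.inv_mem (V₀.mul_mem (V₀.mul_mem (V₀.zpow_mem hvL _) (V₀.zpow_mem hvq _)) hv'), ?_⟩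
  rw [key]
  simp only [map_mul, map_zpow, map_inv]
  apply Additive.ofMul.injective
  simp only [ofMul_mul, ofMul_zpow, ofMul_inv]
  module

/-- **The degree-two law from a generator** (given the degree-one law for `L` everywhere).
[cite: MochizukiEtTh2009, Prop 1.5 (iii) p.23] -/
theorem lawX_of_generator (hρ1 : ∀ m, ρ 1 m = m) (hρmul : ∀ σ τ m, ρ (σ * τ) m = ρ σ (ρ τ m))
    (hκ : ∀ σ, ∀ v ∈ V₀, ∃ v' ∈ V₀, ρ σ (κ v) = κ v')
    (hq : ∀ σ, ∃ v ∈ V₀, ρ σ (κ q) = κ q * κ v)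
    (hL : ∀ σ, ∃ v ∈ V₀, ρ σ L = L * κ q ^ Multiplicative.toAdd (a σ) * κ v)
    {σ₀ : G} (hσ₀ : a σ₀ = Multiplicative.ofAdd 1)
    (h0 : ∃ v ∈ V₀, ρ σ₀ x = x * L ^ (-(2 * Multiplicative.toAdd (a σ₀))) *
      κ q ^ (-(Multiplicative.toAdd (a σ₀) * Multiplicative.toAdd (a σ₀))) * κ v)
    (hker : ∀ y, a y = 1 → ∃ v ∈ V₀, ρ y x = x * κ v) :
    ∀ σ, ∃ v ∈ V₀, ρ σ x = x * L ^ (-(2 * Multiplicative.toAdd (a σ))) *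
      κ q ^ (-(Multiplicative.toAdd (a σ) * Multiplicative.toAdd (a σ))) * κ v := by
  refine of_generator (P := fun σ => ∃ v ∈ V₀, ρ σ x = x * L ^ (-(2 * Multiplicative.toAdd (a σ))) *
      κ q ^ (-(Multiplicative.toAdd (a σ) * Multiplicative.toAdd (a σ))) * κ v) a
    (fun σ τ hσ hτ => lawX_mul hρmul hκ hq hL hσ hτ) (fun σ hσ => lawX_inv hρ1 hρmul hκ hq hL hσ) hσ₀ h0 ?_
  intro y hy
  obtain ⟨v, hv, h⟩ := hker y hy
  refine ⟨v, hv, ?_⟩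
  rw [h, hy, toAdd_one]
  simp

end ZLaw

end Literature.AnabelianGeometry.EtaleTheta
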